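import Summits.CriticalPhenomena.Ising3DConformalLimit.Theses.FKParityRobustness
import Summits.CriticalPhenomena.Ising3DConformalLimit.Theses.IsingEuclidUpgrade
import Literature.Probability.LatticeModels.CriticalUrsellFourSign
import Literature.Probability.LatticeModels.HighDimPointwiseTriviality
import Literature.Probability.LatticeModels.PointwiseScalingLimitScale
import Summits.CriticalPhenomena.Ising3DConformalLimit.Theorems.FKParityRobustnessDefs

/-!
# `JoinForcesU4` (crux stmt-CriticalPhenomena-14627): anatomy, load-bearing hypotheses, dimension sharpness

Negative / structural knowledge about the BRIDGE crux of route `FKParityRobustness`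
(`JoinForcesU4 : IndependentStrandsJoin → [item 0636 inlined]`), from the standing crux disprover's
work file `Cruxes/JoinForcesU4/Disproof.lean` (cycle 1), landed under `Theorems/JoinForcesU4/Negative/`
so that planners, provers and the K1 campaign can import it. No theorem here asserts a route item.

* READ-BACK: `crux_iff` (the bridge is `K1 → NonGaussianLimit`), `conclusion_iff_item0636` (its consequent
  is VERBATIM the crux decl of item 0636 in route `IsingEuclidUpgrade`), `not_crux_iff`,
  `not_crux_imp_gaussianLimit` (a refutation = K1 ∧ a non-degenerate pointwise limit with `U₄ ≡ 0`).
* LOAD-BEARING: `withoutNondegeneracy_iff_not_strandsJoin`, `withoutLimit_iff_not_strandsJoin` (dropping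
  `IsNondegenerateTwoPoint`, resp. the lattice clause, turns the bridge into `¬ K1`),
  `iff_withoutPositivity` (`0 < ρ` is cosmetic). The dropped-hypothesis variants are written inline (no
  named facts).
* FAR MERGING IN DIMENSION `d`: `FarMergingAt d` (the antecedent of item 4471 with `3 ↦ d`),
  `farMerging_gives_U4` (far merging along dilations of a fixed lattice shape forces `U₄^S ≢ 0` for every
  non-degenerate pointwise limit, ANY `d`, any `ρ`), `farMergingGivesU4_iff` (item 4471 is its `d = 3`
  instance up to the unused positivity binder), and `not_farMergingAt_of_exists_limit` (`d ≥ 5`: far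
  merging is impossible once a non-degenerate limit exists — the spine's compliance with the barrier
  `IsingTrivialityFromDimensionFour`, as a theorem).
* WHAT A REFUTATION WOULD BREAK: `latticeBoundFromStrands_iff` (read-back of the glue),
  `hasNontrivialU4_of_tetraBound_io` (the tetrahedral lattice bound infinitely often in the scale already
  gives `U₄^S ≢ 0` for every non-degenerate limit), `not_crux_imp_not_support` (`¬ JoinForcesU4 → ¬ StrandsJoinBound ∨
  ¬ LatticeBoundFromStrands`: a disproof refutes a provable-now support).

## References

* M. Aizenman, H. Duminil-Copin, Ann. Math. 194 (2021), arXiv:1912.07973: §1 p. 5 eq. (1.21) (U₄, Wick's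
  law), p. 6 (`U₄ = O(L^{4-d})`), §3.2 eq. (3.11) p. 9 (random-current form) — pages read
  [AizenmanDuminilCopinAnnals2021].
* M. Aizenman, Comm. Math. Phys. 86 (1982) 1–48 (original source; not held) [AizenmanCMP1982].
-/

noncomputable section

namespace Summit.CriticalPhenomena.Ising3DConformalLimit.Theorems.JoinForcesU4.Negative

open Literature.Probability.LatticeModels Filter Set
open scoped Topology
open Summit.CriticalPhenomena.Ising3DConformalLimit.Theses.FKParityRobustness
open Summit.CriticalPhenomena.Ising3DConformalLimit.Cruxes.ParityRobustMerging.PlaquetteXorSurgery (tetra tetra_inj)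

/-! ### Read-back -/

/-- The bridge is `K1 → NonGaussianLimit` (definitional). [folklore] -/
theorem crux_iff : JoinForcesU4 ↔ (IndependentStrandsJoin → NonGaussianLimit) := Iff.rfl

/-- Its consequent is VERBATIM the crux decl of item 0636 in route `IsingEuclidUpgrade`. [folklore] -/
theorem conclusion_iff_item0636 :
    NonGaussianLimit ↔
      Summit.CriticalPhenomena.Ising3DConformalLimit.Theses.IsingEuclidUpgrade.IsingEuclidUpgradeR4NonGaussian :=
  Iff.rfl

/-- Shape of the negation: `¬ JoinForcesU4 ↔ K1 ∧ ¬ 0636`. [folklore] -/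
theorem not_crux_iff : ¬ JoinForcesU4 ↔ IndependentStrandsJoin ∧ ¬ NonGaussianLimit := by
  rw [crux_iff, Classical.not_imp]

/-- **What a refutation must be**: K1 AND a renormalisation `ρ > 0` with a non-degenerate pointwise
scaling limit of the critical Ising₃ correlators whose connected four-point function vanishes at every
non-coincident quadruple (a Gaussian critical Ising₃ — the 3D non-triviality problem in the direction
contradicted by all evidence; Wick's law for `U₄` is the bellwether of Gaussianity, ADC 2021 §1 p. 5).
[cite: AizenmanDuminilCopinAnnals2021, §1 p. 5, eq. (1.21) (U₄ and Wick's law)] -/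
theorem not_crux_imp_gaussianLimit (h : ¬ JoinForcesU4) :
    IndependentStrandsJoin ∧ ∃ (ρ : ℝ → ℝ) (S : CorrFamily 3), (∀ δ ∈ Set.Ioc (0:ℝ) 1, 0 < ρ δ) ∧
      HasPointwiseScalingLimit (criticalCorr 3) ρ S ∧ IsNondegenerateTwoPoint S ∧
      ∀ x ∈ NonCoincident 3 4, limitConnectedFour S x = 0 := by
  obtain ⟨hK, hN⟩ := not_crux_iff.1 h
  refine ⟨hK, ?_⟩
  simp only [NonGaussianLimit, not_forall, exists_prop] at hN
  obtain ⟨ρ, S, hρ, hlim, hnd, hU⟩ := hN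
  refine ⟨ρ, S, hρ, hlim, hnd, fun x hx => ?_⟩
  by_contra hne
  exact hU ⟨x, hx, hne⟩

/-! ### Load-bearing hypotheses of the consequent -/

/-- The zero family (with the correct constant `criticalCorr 3 0 _` at `n = 0`). [folklore] -/
def zeroFamily : CorrFamily 3 := fun n _ =>
  if n = 0 then criticalCorr 3 0 (fun _ => 0) else 0

/-- `ρ δ = δ` renormalises the critical correlators to the zero family: a GENUINE pointwise scaling
limit of `criticalCorr 3` (`|⟨∏σ⟩| ≤ 1`, so `|δⁿ⟨∏σ⟩| ≤ δ → 0` uniformly for `n ≥ 1`; `n = 0` is a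
constant). [folklore] -/
theorem hasPointwiseScalingLimit_zeroFamily :
    HasPointwiseScalingLimit (criticalCorr 3) (fun δ => δ) zeroFamily := by
  intro n
  rcases Nat.eq_zero_or_pos n with rfl | hn
  · refine TendstoUniformlyOn.tendstoLocallyUniformlyOn (Metric.tendstoUniformlyOn_iff.2 ?_)
    intro ε hε
    refine Filter.Eventually.of_forall fun δ x _ => ?_
    have hx : (fun i : Fin 0 => latticeApprox δ (x i)) = fun _ => (0 : Site 3) :=
      funext fun i => i.elim0
    rw [rescaledCorrelator_apply, hx]
    simp [zeroFamily, hε]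
  · refine TendstoUniformlyOn.tendstoLocallyUniformlyOn (Metric.tendstoUniformlyOn_iff.2 ?_)
    intro ε hε
    have hm : Set.Ioo (0:ℝ) (min 1 ε) ∈ 𝓝[>] (0:ℝ) := Ioo_mem_nhdsGT (lt_min one_pos hε)
    filter_upwards [hm] with δ hδ x _
    have hn0 : n ≠ 0 := hn.ne'
    simp only [zeroFamily, if_neg hn0, rescaledCorrelator_apply, Real.dist_eq, zero_sub, abs_neg, abs_mul,
      abs_pow, abs_of_pos hδ.1]
    have h1 : |criticalCorr 3 n fun i => latticeApprox δ (x i)| ≤ 1 := abs_criticalCorr_le_one le_rfl _ _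
    have hδ1 : δ < 1 := hδ.2.trans_le (min_le_left _ _)
    have hδε : δ < ε := hδ.2.trans_le (min_le_right _ _)
    calc δ ^ n * |criticalCorr 3 n fun i => latticeApprox δ (x i)| ≤ δ ^ n * 1 :=
          mul_le_mul_of_nonneg_left h1 (pow_nonneg hδ.1.le n)
      _ ≤ δ ^ 1 * 1 := by
          refine mul_le_mul_of_nonneg_right (pow_le_pow_of_le_one hδ.1.le hδ1.le hn) zero_le_one
      _ < ε := by simpa using hδε

/-- The zero family has `U₄ ≡ 0`. [folklore] -/
theorem not_hasNontrivialU4_zeroFamily : ¬ HasNontrivialU4 zeroFamily := by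
  rintro ⟨x, -, hne⟩
  exact hne (by simp [limitConnectedFour, zeroFamily])

/-- **Non-degeneracy is load-bearing (unless K1 is false)**: with `IsNondegenerateTwoPoint` dropped,
the bridge is EQUIVALENT to `¬ IndependentStrandsJoin` (witness `ρ δ = δ`, limit `≡ 0`). [folklore] -/
theorem withoutNondegeneracy_iff_not_strandsJoin :
    (IndependentStrandsJoin → ∀ (ρ : ℝ → ℝ) (S : CorrFamily 3), (∀ δ ∈ Set.Ioc (0:ℝ) 1, 0 < ρ δ) →
      HasPointwiseScalingLimit (criticalCorr 3) ρ S → HasNontrivialU4 S) ↔ ¬ IndependentStrandsJoin := by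
  refine ⟨fun h hK => ?_, fun h hK => absurd hK h⟩
  exact not_hasNontrivialU4_zeroFamily
    (h hK (fun δ => δ) zeroFamily (fun _ hδ => hδ.1) hasPointwiseScalingLimit_zeroFamily)

/-- The normalised Wick family at orders 2 and 4: `S₂ ≡ 1`, `S₄ ≡ 3`, `0` elsewhere. [folklore] -/
def wickUnitFamily : CorrFamily 3 := fun n _ =>
  if n = 2 then 1 else if n = 4 then 3 else 0

/-- The unit Wick family is non-degenerate. [folklore] -/
theorem isNondegenerateTwoPoint_wickUnitFamily : IsNondegenerateTwoPoint wickUnitFamily :=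
  fun _ _ => by simp [wickUnitFamily]

/-- The unit Wick family has `U₄ ≡ 0`. [folklore] -/
theorem not_hasNontrivialU4_wickUnitFamily : ¬ HasNontrivialU4 wickUnitFamily := by
  rintro ⟨x, -, hne⟩
  apply hne
  simp [limitConnectedFour, wickUnitFamily]
  norm_num

/-- **The lattice clause is load-bearing (unless K1 is false)**: with `HasPointwiseScalingLimit …`
dropped, the bridge is EQUIVALENT to `¬ IndependentStrandsJoin` (witness: the unit Wick family). [folklore] -/
theorem withoutLimit_iff_not_strandsJoin :
    (IndependentStrandsJoin → ∀ S : CorrFamily 3, IsNondegenerateTwoPoint S → HasNontrivialU4 S) ↔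
      ¬ IndependentStrandsJoin := by
  refine ⟨fun h hK => ?_, fun h hK => absurd hK h⟩
  exact not_hasNontrivialU4_wickUnitFamily (h hK wickUnitFamily isNondegenerateTwoPoint_wickUnitFamily)

/-- A reference non-coincident pair `(0, e₀)`. [folklore] -/
theorem refPair_mem : (![0, EuclideanSpace.single (0 : Fin 3) (1:ℝ)] : Fin 2 → EuclideanSpace ℝ (Fin 3))
    ∈ NonCoincident 3 2 := by
  refine pair_mem_nonCoincident fun h => ?_
  have := congrArg (fun v : EuclideanSpace ℝ (Fin 3) => v 0) h
  simp at this

/-- A limit with `S₂ > 0` at one pair forces `ρ δ ≠ 0` for all small `δ`. [folklore] -/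
theorem eventually_ne_zero_of_limit {ρ : ℝ → ℝ} {S : CorrFamily 3}
    (hlim : HasPointwiseScalingLimit (criticalCorr 3) ρ S) (hnd : IsNondegenerateTwoPoint S) :
    ∀ᶠ δ in 𝓝[>] (0:ℝ), ρ δ ≠ 0 := by
  have h := ((hlim 2).tendsto_at refPair_mem).eventually_const_lt (hnd _ refPair_mem)
  filter_upwards [h] with δ hδ h0
  rw [rescaledCorrelator_apply, h0] at hδ
  norm_num at hδ

/-- **Positivity of `ρ` is cosmetic**: the bridge is equivalent to its version with NO condition on `ρ` (odd critical
correlators vanish — `criticalCorr_eq_zero_of_odd` — so `|ρ|` has the same limit as `ρ`, and `ρ ≠ 0`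
eventually by non-degeneracy; `HasPointwiseScalingLimit.exists_pos_renormalisation`). [folklore] -/
theorem iff_withoutPositivity : JoinForcesU4 ↔
    (IndependentStrandsJoin → ∀ (ρ : ℝ → ℝ) (S : CorrFamily 3),
      HasPointwiseScalingLimit (criticalCorr 3) ρ S → IsNondegenerateTwoPoint S → HasNontrivialU4 S) := by
  refine ⟨fun h hK ρ S hlim hnd => ?_, fun h hK ρ S _ hlim hnd => h hK ρ S hlim hnd⟩
  obtain ⟨ρ', hρ', hlim'⟩ := hlim.exists_pos_renormalisation
    (fun n hn y => criticalCorr_eq_zero_of_odd le_rfl hn y) (eventually_ne_zero_of_limit hlim hnd)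
  exact h hK ρ' S (fun δ _ => hρ' δ) hlim' hnd

/-! ### Far merging along dilations of a lattice shape, in dimension `d` -/

/-- FAR MERGING in dimension `d`: `U₄^crit(L•x) ≤ -c⟨σσ⟩⟨σσ⟩(L•x)` along infinitely many dilations `L`
of a fixed injective lattice shape `x : Fin 4 → ℤ^d` (verbatim the antecedent of item 4471
`FarMergingGivesU4` with `3 ↦ d`; `U₄` as in ADC 2021 eq. (1.21), whose random-current form is
eq. (3.11), p. 9). [cite: AizenmanDuminilCopinAnnals2021, §1 eq. (1.21) and §3.2 eq. (3.11)] -/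
def FarMergingAt (d : ℕ) : Prop :=
  ∃ c : ℝ, 0 < c ∧ ∃ x : Fin 4 → Site d, Function.Injective x ∧ ∀ L₀ : ℕ, ∃ L : ℕ, L₀ ≤ L ∧
    criticalCorr d 4 (fun i => (L : ℤ) • x i) - (criticalCorr d 2 ![(L : ℤ) • x 0, (L : ℤ) • x 1] *
      criticalCorr d 2 ![(L : ℤ) • x 2, (L : ℤ) • x 3] + criticalCorr d 2 ![(L : ℤ) • x 0, (L : ℤ) • x 2] *
      criticalCorr d 2 ![(L : ℤ) • x 1, (L : ℤ) • x 3] + criticalCorr d 2 ![(L : ℤ) • x 0, (L : ℤ) • x 3] *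
      criticalCorr d 2 ![(L : ℤ) • x 1, (L : ℤ) • x 2]) ≤
      -(c * (criticalCorr d 2 ![(L : ℤ) • x 0, (L : ℤ) • x 1] * criticalCorr d 2 ![(L : ℤ) • x 2, (L : ℤ) • x 3]))

/-- Item 4471 is the `d = 3` instance (up to the positivity binder, which is not used). [folklore] -/
theorem farMergingGivesU4_iff : FarMergingGivesU4 ↔ (FarMergingAt 3 → ∀ (ρ : ℝ → ℝ) (S : CorrFamily 3),
    (∀ δ ∈ Set.Ioc (0:ℝ) 1, 0 < ρ δ) → HasPointwiseScalingLimit (criticalCorr 3) ρ S →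
    IsNondegenerateTwoPoint S → HasNontrivialU4 S) :=
  Iff.rfl

/-- At mesh `1/L` the lattice approximation of an integer point (cast to `ℝ^d`) is EXACT:
`[x/(1/L)] = L•x`. [folklore] -/
theorem latticeApprox_inv_natCast_siteVec {d : ℕ} (L : ℕ) (u : Site d) :
    latticeApprox ((L : ℝ)⁻¹) (siteVec u) = (L : ℤ) • u := by
  funext k
  simp only [latticeApprox_apply, siteVec_apply, Pi.smul_apply, smul_eq_mul, div_inv_eq_mul]
  rw [show (u k : ℝ) * (L : ℝ) = (((L : ℤ) * u k : ℤ) : ℝ) by push_cast; ring, Int.floor_intCast]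

/-- Integer points are cast to `ℝ^d` injectively. [folklore] -/
theorem siteVec_injective {d : ℕ} : Function.Injective (siteVec : Site d → EuclideanSpace ℝ (Fin d)) := by
  intro u v h
  funext k
  have := congrArg (fun w : EuclideanSpace ℝ (Fin d) => w k) h
  simp only [siteVec_apply] at this
  exact_mod_cast this

/-- The arithmetic step `U ≤ -c·G·G ⟹ c·(r²G)(r²G) ≤ -(r⁴U)` (multiply by `r⁴ ≥ 0`). [folklore] -/
theorem arith_step {c r G₁ G₂ U : ℝ} (h : U ≤ -(c * (G₁ * G₂))) :
    c * (r ^ 2 * G₁ * (r ^ 2 * G₂)) ≤ -(r ^ 4 * U) := by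
  have h4 : (0:ℝ) ≤ r ^ 4 := by positivity
  nlinarith [mul_le_mul_of_nonneg_left h h4]

/-- **Far merging forces `U₄^S ≢ 0`, in every dimension `d` and for any renormalisation `ρ`**: choose
`L_k ≥ k+1` with the lattice inequality, mesh `δ_k = 1/L_k → 0⁺`, use exactness of the lattice
approximation at integer points (no continuity of `S` needed), multiply by `ρ(δ_k)⁴ ≥ 0` and pass to the
limit (`tendsto_rescaled_criticalUrsellFour`); then `U₄^S(x) ≤ -c S₂S₂ < 0` by non-degeneracy.
Elementary limit argument over the tree's scaling-limit prelude. [folklore] -/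
theorem farMerging_gives_U4 (d : ℕ) (h : FarMergingAt d) :
    ∀ (ρ : ℝ → ℝ) (S : CorrFamily d),
      HasPointwiseScalingLimit (criticalCorr d) ρ S → IsNondegenerateTwoPoint S → HasNontrivialU4 S := by
  rintro ρ S hlim hnd
  obtain ⟨c, hc, x, hx, hL⟩ := h
  choose L hL₀ hineq using hL
  have hLpos : ∀ k, 0 < L (k + 1) := fun k => Nat.lt_of_lt_of_le (Nat.succ_pos k) (hL₀ (k + 1))
  have hy : (fun i => siteVec (x i) : Fin 4 → EuclideanSpace ℝ (Fin d)) ∈ NonCoincident d 4 :=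
    fun i j hij => hx (siteVec_injective hij)
  have hu : Tendsto (fun k : ℕ => ((L (k + 1) : ℕ) : ℝ)⁻¹) atTop (𝓝[>] (0:ℝ)) := by
    refine tendsto_nhdsWithin_iff.2 ⟨?_, Filter.Eventually.of_forall fun k => ?_⟩
    · have h1 : Tendsto (fun k : ℕ => ((L (k + 1) : ℕ) : ℝ)) atTop atTop :=
        tendsto_natCast_atTop_atTop.comp
          (tendsto_atTop_mono (fun k => hL₀ (k + 1)) (tendsto_add_atTop_nat 1))
      exact h1.inv_tendsto_atTop
    · exact Set.mem_Ioi.2 (inv_pos.2 (Nat.cast_pos.2 (hLpos k)))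
  have happrox : ∀ (k : ℕ) (i : Fin 4),
      latticeApprox (((L (k + 1) : ℕ) : ℝ)⁻¹) (siteVec (x i)) = ((L (k + 1) : ℕ) : ℤ) • x i :=
    fun k i => latticeApprox_inv_natCast_siteVec (L (k + 1)) (x i)
  have hU := (tendsto_rescaled_criticalUrsellFour hlim hy).comp hu
  have hpair : ∀ i j, i ≠ j → Tendsto
      (fun δ => ρ δ ^ 2 * criticalCorr d 2 ![latticeApprox δ (siteVec (x i)), latticeApprox δ (siteVec (x j))])
      (𝓝[>] 0) (𝓝 (S 2 ![siteVec (x i), siteVec (x j)])) := by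
    intro i j hij
    have hmem : (![siteVec (x i), siteVec (x j)] : Fin 2 → EuclideanSpace ℝ (Fin d)) ∈ NonCoincident d 2 :=
      pair_mem_nonCoincident fun h => hij (hx (siteVec_injective h))
    refine Tendsto.congr (fun δ => ?_) ((hlim 2).tendsto_at hmem)
    rw [rescaledCorrelator_apply, latticeApprox_comp_two]
    rfl
  have hB := ((((hpair 0 1 (by decide)).mul (hpair 2 3 (by decide))).const_mul c)).comp hu
  have hle : c * (S 2 ![siteVec (x 0), siteVec (x 1)] * S 2 ![siteVec (x 2), siteVec (x 3)]) ≤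
      - limitConnectedFour S (fun i => siteVec (x i)) := by
    refine le_of_tendsto_of_tendsto hB hU.neg (Filter.Eventually.of_forall fun k => ?_)
    simp only [Function.comp_apply, happrox]
    exact arith_step (hineq (k + 1))
  have h01 : (![siteVec (x 0), siteVec (x 1)] : Fin 2 → EuclideanSpace ℝ (Fin d)) ∈ NonCoincident d 2 :=
    pair_mem_nonCoincident fun h => absurd (hx (siteVec_injective h)) (by decide)
  have h23 : (![siteVec (x 2), siteVec (x 3)] : Fin 2 → EuclideanSpace ℝ (Fin d)) ∈ NonCoincident d 2 :=
    pair_mem_nonCoincident fun h => absurd (hx (siteVec_injective h)) (by decide)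
  have hpos : 0 < c * (S 2 ![siteVec (x 0), siteVec (x 1)] * S 2 ![siteVec (x 2), siteVec (x 3)]) :=
    mul_pos hc (mul_pos (hnd _ h01) (hnd _ h23))
  exact ⟨_, hy, (by linarith : limitConnectedFour S (fun i => siteVec (x i)) < 0).ne⟩

/-- **Dimension sharpness** (`d ≥ 5`): far merging along dilations is IMPOSSIBLE as soon as a
non-degenerate pointwise limit exists — every such limit has `U₄ ≡ 0` off the diagonals
(`limitConnectedFour_eq_zero_of_hasPointwiseScalingLimit_holds`, Aizenman 1982 / Fröhlich 1982),
contradicting `farMerging_gives_U4`. Since `StrandsJoinBound` is a dimension-free finite-graph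
inequality and the box → `ℤ^d` glue is dimension-uniform, the `d ≥ 5` analogue of the spine
K1_d ⟹ `FarMergingAt d` fails exactly at K1_d: any proof of K1 must use `d < 4` (ADC 2021 §1, p. 6:
`U₄ = O(L^{4-d})`, which for `d > 4` vanishes). [cite: AizenmanDuminilCopinAnnals2021, §1 p. 6 (U₄ = O(L^{4-d}) for d > 4)] -/
theorem not_farMergingAt_of_exists_limit {d : ℕ} (hd : 5 ≤ d)
    (hex : ∃ (ρ : ℝ → ℝ) (S : CorrFamily d), (∀ δ ∈ Set.Ioc (0:ℝ) 1, 0 < ρ δ) ∧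
      HasPointwiseScalingLimit (criticalCorr d) ρ S ∧ IsNondegenerateTwoPoint S) :
    ¬ FarMergingAt d := by
  intro hfm
  obtain ⟨ρ, S, hρ, hlim, hnd⟩ := hex
  obtain ⟨x, hx, hne⟩ := farMerging_gives_U4 d hfm ρ S hlim hnd
  exact hne (limitConnectedFour_eq_zero_of_hasPointwiseScalingLimit_holds hd ρ S hρ hlim hnd x hx)

/-! ### What a refutation of the bridge would break -/

/-- The lattice `U₄` bound at the `l`-fold tetrahedron with constant `c` (the summand of the conclusion
of the glue `LatticeBoundFromStrands`; `tetra` is the route's unit tetrahedron from `FKParityRobustnessDefs`). [folklore] -/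
def tetraBound (c : ℝ) (l : ℕ) : Prop :=
  criticalCorr 3 4 (fun i => (l : ℤ) • tetra i) - (criticalCorr 3 2 ![(l : ℤ) • tetra 0, (l : ℤ) • tetra 1] *
    criticalCorr 3 2 ![(l : ℤ) • tetra 2, (l : ℤ) • tetra 3] + criticalCorr 3 2 ![(l : ℤ) • tetra 0, (l : ℤ) • tetra 2] *
    criticalCorr 3 2 ![(l : ℤ) • tetra 1, (l : ℤ) • tetra 3] + criticalCorr 3 2 ![(l : ℤ) • tetra 0, (l : ℤ) • tetra 3] *
    criticalCorr 3 2 ![(l : ℤ) • tetra 1, (l : ℤ) • tetra 2]) ≤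
    -(c * (criticalCorr 3 2 ![(l : ℤ) • tetra 0, (l : ℤ) • tetra 1] * criticalCorr 3 2 ![(l : ℤ) • tetra 2, (l : ℤ) • tetra 3]))

/-- Read-back: the glue `LatticeBoundFromStrands` is `K1 → StrandsJoinBound → ∃ c > 0, ∀ l ≥ 1, tetraBound c l`
(definitional). [folklore] -/
theorem latticeBoundFromStrands_iff :
    LatticeBoundFromStrands ↔
      (IndependentStrandsJoin → StrandsJoinBound → ∃ c : ℝ, 0 < c ∧ ∀ l : ℕ, 1 ≤ l → tetraBound c l) :=
  Iff.rfl

/-- The tetrahedral lattice bound INFINITELY OFTEN in the scale already gives `U₄^S ≢ 0` for every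
non-degenerate pointwise limit (item 4471 at `x = tetra`; only infinitely many dilations are used, so K1
could be weakened to its limsup-in-`l` form without changing the spine's shape). [folklore] -/
theorem hasNontrivialU4_of_tetraBound_io
    (h : ∃ c : ℝ, 0 < c ∧ ∀ l₀ : ℕ, ∃ l : ℕ, l₀ ≤ l ∧ tetraBound c l) {ρ : ℝ → ℝ} {S : CorrFamily 3}
    (hlim : HasPointwiseScalingLimit (criticalCorr 3) ρ S) (hnd : IsNondegenerateTwoPoint S) :
    HasNontrivialU4 S := by
  obtain ⟨c, hc, hl⟩ := h
  exact farMerging_gives_U4 3 ⟨c, hc, tetra, tetra_inj, hl⟩ ρ S hlim hnd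

/-- **What a refutation of the bridge would break**: one of the two dimension-free, provable-now supports
of the route — the finite-graph Aizenman-type inequality `StrandsJoinBound` (item 14647) or the box → `ℤ³`
glue `LatticeBoundFromStrands` (item 14648) — since the third factor (item 4471) is `farMerging_gives_U4`.
Contrapositive of the planner's composite `joinForcesU4_of`. [folklore] -/
theorem not_crux_imp_not_support (h : ¬ JoinForcesU4) : ¬ StrandsJoinBound ∨ ¬ LatticeBoundFromStrands := by
  by_cases h₁ : StrandsJoinBound
  · refine Or.inr fun h₂ => h fun hK => ?_
    obtain ⟨c, hc, hl⟩ := (latticeBoundFromStrands_iff.1 h₂) hK h₁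
    exact fun ρ S _ hlim hnd => hasNontrivialU4_of_tetraBound_io
      ⟨c, hc, fun l₀ => ⟨max l₀ 1, le_max_left _ _, hl _ (le_max_right _ _)⟩⟩ hlim hnd
  · exact Or.inl h₁

end Summit.CriticalPhenomena.Ising3DConformalLimit.Theorems.JoinForcesU4.Negative
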